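import Literature.Computability.Complexity.FoldCatBricks
import Literature.Computability.Complexity.PlumbingBricks
import Literature.Computability.Complexity.StringEquality
import Literature.Computability.Complexity.FPStringBricks
import Literature.Computability.Complexity.IsqrtBrick
import HarnessLib

/-!
# Clique-verifier bricks: checking a clique certificate against a square bit matrix is in `FP`

Trunk `CplxCore`, toolkit in the `FP` string-algebra style of `BrickAlgebra.lean` /
`FoldCatBricks.lean` / `UpperTriangleBricks.lean`, written for the slice plumbing of
negation-limited circuit lower bounds with an `NP`-complete witness
(`Summits/PneNP/PneNP/Theorems/NegLimitedCliqueSlices.lean`: the `⌊√m⌋`-clique language, whose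
slices at square lengths are `CLIQUE(m, ⌊√m⌋)` of the upper triangle).

Input: a pair `⟨u, y⟩` of an `m × m` bit matrix `u` (`|u| = m²`, the graph is read off the strict
upper triangle, row-major) and a certificate `y`, of which the first `m` bits `y' = y ↾ m` are the
indicator vector of a vertex set `S`.
* `CliqueVerifier.accepts u y m`: `y'` has exactly `⌊√m⌋` ones, and for every position `t < m²`
  with `t / m < t mod m` both in `S`, the entry `u_t` is `1` (every pair of `S` is an edge).
* **`CliqueVerifier.verFn ∈ FP`** (`verFn_mem_FP`) with **`verFn ⟨u, y⟩ = [accepts u y m]`** for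
  `|u| = m²` (`verFn_sq`): two concatenation folds (`Brick.foldCat`) — one collecting a `1` per one
  of `y'` (compared with `1^{⌊√m⌋}` by `eqPairFn`), one collecting a `1` per violated pair
  (compared with `ε`) — over piece functions assembled from `Plumb.divModFn`
  (`t ↦ (t / m, t mod m)`), `bitAtFn`, `eqPairFn`, `andFn`/`notFn`/`iteFn`; the sides `1ᵐ`,
  `1^{⌊√m⌋}` come from `isqrtFn`/`binToUnaryFn`.

## References

* S. Arora, B. Barak, *Computational Complexity: A Modern Approach*, CUP 2009, §1.3 (polynomial
  time is closed under composition and bounded loops), §2.1 (certificate definition of `NP`,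
  Example 2.2: `CLIQUE`/`INDSET ∈ NP`).
-/

namespace Literature.Computability.Complexity

open _root_.Computability Polynomial Brick

namespace CliqueVerifier

/-- **Acceptance test** (Boolean): the first `m` bits of the certificate mark exactly `⌊√m⌋`
vertices, every two of which (`a = t / m < b = t mod m`) are joined in the upper triangle of `u`
(`u_t = 1`). [cite: AroraBarak2009, §2.1 Ex. 2.2] -/
def accepts (u y : List Bool) (m : ℕ) : Bool :=
  decide ((y.take m).count true = Nat.sqrt m) &&
    decide (∀ t, t < m * m → t / m < t % m → (y.take m).getD (t / m) false = true →
      (y.take m).getD (t % m) false = true → u.getD t false = true)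

/-- Unfolding the acceptance test. [cite: AroraBarak2009, §2.1 Ex. 2.2] -/
theorem accepts_eq_true_iff {u y : List Bool} {m : ℕ} :
    accepts u y m = true ↔ (y.take m).count true = Nat.sqrt m ∧
      ∀ t, t < m * m → t / m < t % m → (y.take m).getD (t / m) false = true →
        (y.take m).getD (t % m) false = true → u.getD t false = true := by
  simp only [accepts, Bool.and_eq_true, decide_eq_true_iff]

noncomputable section

/-! ### The function -/

/-- The matrix `u` of `⟨u, y⟩`. [folklore] -/
def vU : List Bool → List Bool := fstF
/-- The certificate `y` of `⟨u, y⟩`. [folklore] -/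
def vY : List Bool → List Bool := sndF
/-- The side `1ᵐ`, `m = ⌊√|u|⌋`. [folklore] -/
def vM : List Bool → List Bool := binToUnaryFn ∘ fanoutFn vU (isqrtFn ∘ vU)
/-- The clique size `1ᵏ`, `k = ⌊√m⌋`. [folklore] -/
def vK : List Bool → List Bool := binToUnaryFn ∘ fanoutFn vM (isqrtFn ∘ vM)
/-- The truncated certificate `y' = y ↾ m`. [folklore] -/
def vY' : List Bool → List Bool := Plumb.takeFn ∘ fanoutFn vM vY

/-- The one-bit test "the bit of `s` at position `|p|` is (present and) `1`". [folklore] -/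
def bitTest (p s : List Bool → List Bool) : List Bool → List Bool :=
  eqPairFn ∘ fanoutFn (bitAtFn ∘ fanoutFn p s) (fun _ => [true])

/-- Popcount piece on `⟨y', 1ᵗ⟩`: `1` if `y'_t = 1`, else `ε`. [folklore] -/
def popPiece : List Bool → List Bool := iteFn (bitTest sndF fstF) (fun _ => [true]) (fun _ => [])
/-- `1^{#ones of y'}`: the popcount fold. [cite: AroraBarak2009, §1.3 (bounded loops)] -/
def popFn : List Bool → List Bool := foldCat 1 X popPiece ∘ fanoutFn vY' vY'
/-- The count test `[#ones of y' = ⌊√m⌋]`. [folklore] -/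
def cntOK : List Bool → List Bool := eqPairFn ∘ fanoutFn popFn vK

/-- Piece record `⟨⟨u, ⟨1ᵐ, y'⟩⟩, 1ᵗ⟩`: the matrix. [folklore] -/
def rU : List Bool → List Bool := fstF ∘ fstF
/-- Piece record: the side `1ᵐ`. [folklore] -/
def rM : List Bool → List Bool := fstF ∘ (sndF ∘ fstF)
/-- Piece record: the truncated certificate `y'`. [folklore] -/
def rY : List Bool → List Bool := sndF ∘ (sndF ∘ fstF)
/-- Piece record: the position `1ᵗ`. [folklore] -/
def rT : List Bool → List Bool := sndF
/-- `⟨1^{t / m}, 1^{t mod m}⟩` (the carrying counter `Plumb.divModFn`). [folklore] -/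
def rAB : List Bool → List Bool := Plumb.divModFn ∘ fanoutFn rM rT
/-- The row `1^{t / m}`. [folklore] -/
def rA : List Bool → List Bool := fstF ∘ rAB
/-- The column `1^{t mod m}`. [folklore] -/
def rB : List Bool → List Bool := sndF ∘ rAB
/-- The violation test `[t/m < t mod m ∧ y'_{t/m} ∧ y'_{t mod m} ∧ ¬ u_t]`. [folklore] -/
def rViol : List Bool → List Bool :=
  andFn (bitTest rA rB) (andFn (bitTest rA rY) (andFn (bitTest rB rY) (notFn (bitTest rT rU))))
/-- Violation piece: `1` on a violated pair, else `ε`. [folklore] -/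
def violPiece : List Bool → List Bool := iteFn rViol (fun _ => [true]) (fun _ => [])
/-- `1^{#violated pairs}`: the violation fold over the positions `t < |u|`.
[cite: AroraBarak2009, §1.3 (bounded loops)] -/
def violFn : List Bool → List Bool :=
  foldCat 1 X violPiece ∘ fanoutFn (fanoutFn vU (fanoutFn vM vY')) vU
/-- The edge test `[no violated pair]`. [folklore] -/
def edgesOK : List Bool → List Bool := eqPairFn ∘ fanoutFn violFn (fun _ => [])

/-- **The clique verifier**: count test and edge test. [cite: AroraBarak2009, §2.1 Ex. 2.2] -/
def verFn : List Bool → List Bool := andFn cntOK edgesOK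

/-! ### Polynomial time -/

/-- `vU ∈ FP`. [cite: AroraBarak2009, §1.3] -/
private theorem vU_mem_FP : vU ∈ FP := fstF_mem_FP
/-- `vY ∈ FP`. [cite: AroraBarak2009, §1.3] -/
private theorem vY_mem_FP : vY ∈ FP := sndF_mem_FP
/-- `vM ∈ FP`. [cite: AroraBarak2009, §1.3] -/
private theorem vM_mem_FP : vM ∈ FP :=
  comp_mem_FP binToUnaryFn_mem_FP (fanoutFn_mem_FP vU_mem_FP (comp_mem_FP isqrtFn_mem_FP vU_mem_FP))
/-- `vK ∈ FP`. [cite: AroraBarak2009, §1.3] -/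
private theorem vK_mem_FP : vK ∈ FP :=
  comp_mem_FP binToUnaryFn_mem_FP (fanoutFn_mem_FP vM_mem_FP (comp_mem_FP isqrtFn_mem_FP vM_mem_FP))
/-- `vY' ∈ FP`. [cite: AroraBarak2009, §1.3] -/
private theorem vY'_mem_FP : vY' ∈ FP :=
  comp_mem_FP Plumb.takeFn_mem_FP (fanoutFn_mem_FP vM_mem_FP vY_mem_FP)
/-- `bitTest p s ∈ FP`. [cite: AroraBarak2009, §1.3] -/
private theorem bitTest_mem_FP {p s : List Bool → List Bool} (hp : p ∈ FP) (hs : s ∈ FP) :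
    bitTest p s ∈ FP :=
  comp_mem_FP eqPairFn_mem_FP
    (fanoutFn_mem_FP (comp_mem_FP bitAtFn_mem_FP (fanoutFn_mem_FP hp hs)) (const_mem_FP _))
/-- `popPiece ∈ FP`. [cite: AroraBarak2009, §1.3] -/
private theorem popPiece_mem_FP : popPiece ∈ FP :=
  iteFn_mem_FP (bitTest_mem_FP sndF_mem_FP fstF_mem_FP) (const_mem_FP _) (const_mem_FP _)
/-- `popFn ∈ FP`. [cite: AroraBarak2009, §1.3] -/
private theorem popFn_mem_FP : popFn ∈ FP :=
  comp_mem_FP (foldCat_mem_FP 1 X popPiece_mem_FP) (fanoutFn_mem_FP vY'_mem_FP vY'_mem_FP)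
/-- `cntOK ∈ FP`. [cite: AroraBarak2009, §1.3] -/
private theorem cntOK_mem_FP : cntOK ∈ FP :=
  comp_mem_FP eqPairFn_mem_FP (fanoutFn_mem_FP popFn_mem_FP vK_mem_FP)
/-- `rU ∈ FP`. [cite: AroraBarak2009, §1.3] -/
private theorem rU_mem_FP : rU ∈ FP := comp_mem_FP fstF_mem_FP fstF_mem_FP
/-- `rM ∈ FP`. [cite: AroraBarak2009, §1.3] -/
private theorem rM_mem_FP : rM ∈ FP := comp_mem_FP fstF_mem_FP (comp_mem_FP sndF_mem_FP fstF_mem_FP)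
/-- `rY ∈ FP`. [cite: AroraBarak2009, §1.3] -/
private theorem rY_mem_FP : rY ∈ FP := comp_mem_FP sndF_mem_FP (comp_mem_FP sndF_mem_FP fstF_mem_FP)
/-- `rT ∈ FP`. [cite: AroraBarak2009, §1.3] -/
private theorem rT_mem_FP : rT ∈ FP := sndF_mem_FP
/-- `rAB ∈ FP`. [cite: AroraBarak2009, §1.3] -/
private theorem rAB_mem_FP : rAB ∈ FP :=
  comp_mem_FP Plumb.divModFn_mem_FP (fanoutFn_mem_FP rM_mem_FP rT_mem_FP)
/-- `rA ∈ FP`. [cite: AroraBarak2009, §1.3] -/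
private theorem rA_mem_FP : rA ∈ FP := comp_mem_FP fstF_mem_FP rAB_mem_FP
/-- `rB ∈ FP`. [cite: AroraBarak2009, §1.3] -/
private theorem rB_mem_FP : rB ∈ FP := comp_mem_FP sndF_mem_FP rAB_mem_FP
/-- `rViol ∈ FP`. [cite: AroraBarak2009, §1.3] -/
private theorem rViol_mem_FP : rViol ∈ FP :=
  andFn_mem_FP (bitTest_mem_FP rA_mem_FP rB_mem_FP) (andFn_mem_FP (bitTest_mem_FP rA_mem_FP rY_mem_FP)
    (andFn_mem_FP (bitTest_mem_FP rB_mem_FP rY_mem_FP) (notFn_mem_FP (bitTest_mem_FP rT_mem_FP rU_mem_FP))))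
/-- `violPiece ∈ FP`. [cite: AroraBarak2009, §1.3] -/
private theorem violPiece_mem_FP : violPiece ∈ FP :=
  iteFn_mem_FP rViol_mem_FP (const_mem_FP _) (const_mem_FP _)
/-- `violFn ∈ FP`. [cite: AroraBarak2009, §1.3] -/
private theorem violFn_mem_FP : violFn ∈ FP :=
  comp_mem_FP (foldCat_mem_FP 1 X violPiece_mem_FP)
    (fanoutFn_mem_FP (fanoutFn_mem_FP vU_mem_FP (fanoutFn_mem_FP vM_mem_FP vY'_mem_FP)) vU_mem_FP)
/-- `edgesOK ∈ FP`. [cite: AroraBarak2009, §1.3] -/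
private theorem edgesOK_mem_FP : edgesOK ∈ FP :=
  comp_mem_FP eqPairFn_mem_FP (fanoutFn_mem_FP violFn_mem_FP (const_mem_FP _))

/-- **`verFn ∈ FP`.** [cite: AroraBarak2009, §1.3 (bounded loops)] -/
theorem verFn_mem_FP : verFn ∈ FP := andFn_mem_FP cntOK_mem_FP edgesOK_mem_FP

/-! ### Semantics -/

/-- `take 1 ∘ drop a` is `[true]` iff the bit at `a` is (present and) `1`. [folklore] -/
private theorem take_one_drop_eq_true_iff (s : List Bool) (a : ℕ) :
    (s.drop a).take 1 = [true] ↔ s.getD a false = true := by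
  by_cases h : a < s.length
  · rw [List.take_one_drop_eq_of_lt_length h, List.getD_eq_getElem _ _ h]
    simp
  · rw [List.drop_eq_nil_of_le (by omega), List.getD_eq_default _ _ (by omega)]
    simp

/-- **Value of `bitTest`**: `[s.getD |p| false]`. [folklore] -/
private theorem bitTest_apply (p s : List Bool → List Bool) (z : List Bool) :
    bitTest p s z = [(s z).getD (p z).length false] := by
  simp only [bitTest, Function.comp_apply, fanoutFn_apply, bitAtFn_boolPair, eqPairFn_boolPair]
  congr 1
  rw [Bool.eq_iff_iff, decide_eq_true_iff, take_one_drop_eq_true_iff]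

/-- A bit of `1ᵇ`: `[a < b]`. [folklore] -/
private theorem getD_ones (a b : ℕ) : (ones b).getD a false = decide (a < b) := by
  by_cases h : a < b
  · rw [List.getD_eq_getElem _ _ (by simpa [ones] using h)]
    simp [ones, h]
  · rw [List.getD_eq_default _ _ (by simpa [ones] using h)]
    simp [h]

/-- The side of a square matrix: `vM ⟨u, y⟩ = 1ᵐ` for `|u| = m²`. [folklore] -/
private theorem vM_sq {u y : List Bool} {m : ℕ} (hu : u.length = m * m) :
    vM (boolPair u y) = ones m := by
  simp only [vM, vU, Function.comp_apply, fanoutFn_apply, fstF_boolPair, isqrtFn_apply,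
    binToUnaryFn_boolPair, bitsToNat_encodeNat, hu, Nat.sqrt_eq, min_eq_left (Nat.le_mul_self m)]

/-- The clique size: `vK ⟨u, y⟩ = 1^{⌊√m⌋}` for `|u| = m²`. [folklore] -/
private theorem vK_sq {u y : List Bool} {m : ℕ} (hu : u.length = m * m) :
    vK (boolPair u y) = ones (Nat.sqrt m) := by
  simp only [vK, Function.comp_apply, fanoutFn_apply, vM_sq hu, isqrtFn_apply,
    binToUnaryFn_boolPair, bitsToNat_encodeNat]
  simp [ones, min_eq_left (Nat.sqrt_le_self m)]

/-- The truncated certificate: `vY' ⟨u, y⟩ = y ↾ m` for `|u| = m²`. [folklore] -/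
private theorem vY'_sq {u y : List Bool} {m : ℕ} (hu : u.length = m * m) :
    vY' (boolPair u y) = y.take m := by
  simp only [vY', vY, Function.comp_apply, fanoutFn_apply, vM_sq hu, sndF_boolPair,
    Plumb.takeFn_boolPair]
  simp [ones]

/-- **Value of the popcount piece** on `⟨y', 1ᵗ⟩`. [folklore] -/
private theorem popPiece_apply (y' : List Bool) (t : ℕ) :
    popPiece (boolPair y' (ones t)) = if y'.getD t false = true then [true] else [] := by
  have h := bitTest_apply sndF fstF (boolPair y' (ones t))
  simp only [sndF_boolPair, fstF_boolPair] at h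
  rw [popPiece, iteFn_apply h]
  simp [ones]

/-- The popcount concatenation is `1^{count}`. [folklore] -/
private theorem ccat_pop : ∀ (l : List Bool),
    ccat (fun t => if l.getD t false = true then [true] else []) l.length = ones (l.count true) := by
  intro l
  induction l using List.reverseRecOn with
  | nil => simp [ones]
  | append_singleton l b ih =>
    rw [List.length_append, List.length_singleton, ccat_succ]
    have h1 : ccat (fun t => if (l ++ [b]).getD t false = true then [true] else []) l.length =
        ccat (fun t => if l.getD t false = true then [true] else []) l.length :=
      ccat_congr fun t ht => by rw [List.getD_append _ _ _ _ ht]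
    rw [h1, ih, List.getD_append_right _ _ _ _ le_rfl, Nat.sub_self, List.getD_cons_zero,
      List.count_append, List.count_singleton']
    cases b <;> simp [ones, List.replicate_add]

/-- **Value of the popcount fold**: `popFn ⟨u, y⟩ = 1^{#ones of y ↾ m}`. [folklore] -/
private theorem popFn_sq {u y : List Bool} {m : ℕ} (hu : u.length = m * m) :
    popFn (boolPair u y) = ones ((y.take m).count true) := by
  rw [popFn, Function.comp_apply, fanoutFn_apply, vY'_sq hu, foldCat_apply]
  · rw [← ccat_pop]
    exact ccat_congr fun t _ => popPiece_apply _ t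
  · simp only [eval_X]; exact le_rfl
  · intro t _
    rw [popPiece_apply]
    split_ifs <;> simp

/-- **Value of the count test.** [folklore] -/
private theorem cntOK_sq {u y : List Bool} {m : ℕ} (hu : u.length = m * m) :
    cntOK (boolPair u y) = [decide ((y.take m).count true = Nat.sqrt m)] := by
  simp only [cntOK, Function.comp_apply, fanoutFn_apply, popFn_sq hu, vK_sq hu, eqPairFn_boolPair]
  congr 1
  rw [Bool.eq_iff_iff, decide_eq_true_iff, decide_eq_true_iff]
  constructor
  · intro h; simpa [ones] using congrArg List.length h
  · intro h; rw [h]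

/-- The violation piece record. [folklore] -/
private def rec (u y' : List Bool) (m t : ℕ) : List Bool :=
  boolPair (boolPair u (boolPair (ones m) y')) (ones t)

/-- `rU` of a record. [folklore] -/
@[simp] private theorem rU_rec (u y' : List Bool) (m t : ℕ) : rU (rec u y' m t) = u := by
  simp [rU, rec]
/-- `rM` of a record. [folklore] -/
@[simp] private theorem rM_rec (u y' : List Bool) (m t : ℕ) : rM (rec u y' m t) = ones m := by
  simp [rM, rec]
/-- `rY` of a record. [folklore] -/
@[simp] private theorem rY_rec (u y' : List Bool) (m t : ℕ) : rY (rec u y' m t) = y' := by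
  simp [rY, rec]
/-- `rT` of a record. [folklore] -/
@[simp] private theorem rT_rec (u y' : List Bool) (m t : ℕ) : rT (rec u y' m t) = ones t := by
  simp [rT, rec]
/-- `rAB` of a record: `⟨1^{t / m}, 1^{t mod m}⟩`. [folklore] -/
@[simp] private theorem rAB_rec (u y' : List Bool) (m t : ℕ) :
    rAB (rec u y' m t) = boolPair (ones (t / m)) (ones (t % m)) := by
  simp only [rAB, Function.comp_apply, fanoutFn_apply, rM_rec, rT_rec]
  exact Plumb.divModFn_boolPair m t
/-- `rA` of a record. [folklore] -/
@[simp] private theorem rA_rec (u y' : List Bool) (m t : ℕ) : rA (rec u y' m t) = ones (t / m) := by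
  simp [rA]
/-- `rB` of a record. [folklore] -/
@[simp] private theorem rB_rec (u y' : List Bool) (m t : ℕ) : rB (rec u y' m t) = ones (t % m) := by
  simp [rB]

/-- The violation test at position `t` (Boolean). [folklore] -/
private def viol (u y' : List Bool) (m t : ℕ) : Bool :=
  decide (t / m < t % m) && (y'.getD (t / m) false && (y'.getD (t % m) false && !(u.getD t false)))

/-- **Value of the violation test** on a record. [folklore] -/
private theorem rViol_rec (u y' : List Bool) (m t : ℕ) :
    rViol (rec u y' m t) = [viol u y' m t] := by
  have hlt := bitTest_apply rA rB (rec u y' m t)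
  have hya := bitTest_apply rA rY (rec u y' m t)
  have hyb := bitTest_apply rB rY (rec u y' m t)
  have hut := bitTest_apply rT rU (rec u y' m t)
  simp only [rA_rec, rB_rec, rY_rec, rT_rec, rU_rec, getD_ones] at hlt hya hyb hut
  simp only [ones, List.length_replicate] at hlt hya hyb hut
  rw [rViol, andFn_apply hlt (andFn_apply hya (andFn_apply hyb (notFn_apply hut))), viol]

/-- **Value of the violation piece.** [folklore] -/
private theorem violPiece_rec (u y' : List Bool) (m t : ℕ) :
    violPiece (rec u y' m t) = if viol u y' m t then [true] else [] := by
  rw [violPiece, iteFn_apply (rViol_rec u y' m t)]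

/-- A concatenation of `1`/`ε` pieces is empty iff no piece fires. [folklore] -/
private theorem ccat_ite_eq_nil_iff {P : ℕ → Prop} [DecidablePred P] : ∀ {k : ℕ},
    ccat (fun t => if P t then [true] else []) k = [] ↔ ∀ t, t < k → ¬ P t
  | 0 => by simp
  | k + 1 => by
    rw [ccat_succ, List.append_eq_nil_iff, ccat_ite_eq_nil_iff]
    constructor
    · rintro ⟨h, h'⟩ t ht
      rcases Nat.lt_succ_iff_lt_or_eq.1 ht with ht | rfl
      · exact h t ht
      · intro hP; simp [hP] at h'
    · intro h
      exact ⟨fun t ht => h t (by omega), by simp [h k (by omega)]⟩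

/-- **Value of the violation fold**: empty iff no violated pair. [folklore] -/
private theorem violFn_sq_eq_nil_iff {u y : List Bool} {m : ℕ} (hu : u.length = m * m) :
    violFn (boolPair u y) = [] ↔ ∀ t, t < m * m → ¬ viol u (y.take m) m t = true := by
  have hx : fanoutFn (fanoutFn vU (fanoutFn vM vY')) vU (boolPair u y) =
      boolPair (boolPair u (boolPair (ones m) (y.take m))) u := by
    simp only [fanoutFn_apply, vU, fstF_boolPair, vM_sq hu, vY'_sq hu]
  rw [violFn, Function.comp_apply, hx, foldCat_apply, hu]
  · rw [← ccat_ite_eq_nil_iff (P := fun t => viol u (y.take m) m t = true)]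
    exact Iff.of_eq (congrArg (· = []) (ccat_congr fun t _ => by
      rw [show boolPair (boolPair u (boolPair (ones m) (y.take m))) (ones t) = rec u (y.take m) m t
        from rfl, violPiece_rec]))
  · simp only [eval_X, length_boolPair]; omega
  · intro t _
    rw [show boolPair (boolPair u (boolPair (ones m) (y.take m))) (ones t) = rec u (y.take m) m t
      from rfl, violPiece_rec]
    split_ifs <;> simp

/-- **Value of the edge test.** [folklore] -/
private theorem edgesOK_sq {u y : List Bool} {m : ℕ} (hu : u.length = m * m) :
    edgesOK (boolPair u y) = [decide (∀ t, t < m * m → ¬ viol u (y.take m) m t = true)] := by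
  simp only [edgesOK, Function.comp_apply, fanoutFn_apply, eqPairFn_boolPair]
  congr 1
  rw [Bool.eq_iff_iff, decide_eq_true_iff, decide_eq_true_iff, violFn_sq_eq_nil_iff hu]

/-- **The clique verifier on a square matrix**: `verFn ⟨u, y⟩ = [accepts u y m]` for `|u| = m²`.
[Arora–Barak 2009, §2.1 (Def. 2.1, Ex. 2.2)] [cite: AroraBarak2009, §2.1 Ex. 2.2] -/
theorem verFn_sq {u y : List Bool} {m : ℕ} (hu : u.length = m * m) :
    verFn (boolPair u y) = [accepts u y m] := by
  rw [verFn, andFn_apply (cntOK_sq hu) (edgesOK_sq hu)]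
  congr 1
  rw [Bool.eq_iff_iff]
  simp only [accepts, Bool.and_eq_true, decide_eq_true_iff]
  refine and_congr Iff.rfl (forall_congr' fun t => forall_congr' fun ht => ?_)
  simp only [viol, Bool.and_eq_true, decide_eq_true_iff, Bool.not_eq_true', not_and,
    Bool.not_eq_false]

end

end CliqueVerifier

end Literature.Computability.Complexity
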